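import Summits.CriticalPhenomena.PercolationContinuityZ3.Theses.PercNearOneGluing
import Literature.Probability.Percolation.PercolationProofs
import Literature.Probability.Percolation.TwoClusterConditionalAssociation

/-!
Sketch (stub-ideation k=1, FAMILY 1 — RECOGNISE & IMPORT) for `stub_goodStep` of the crux
`PercNearOneGluing.AdditiveGluing` (stmt-CriticalPhenomena-4576), line `subuniform-dead-pocket-maximum`.
Helper-lemma SIGNATURES only (bodies `sorry`): the Kozma–Nitzan §3.1 three-relay pattern calculus
(arXiv:2401.12397 Lemma 1/2 p.5–6, Theorem 2 p.8–9, Lemma 4 + (9) p.9, Theorem 3 p.10–12) and the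
set-source van den Berg–Häggström–Kahn inequalities it runs on (RSA 29 (2006) Thms 1.2/1.4; vdB–Kahn
AoP 29 (2001) Thm 1.2 + Remark 3), none of which is in the tree (lean search: no `knLemma2`, `knThm2`,
`knLemma4`, `knThm3`, no BHK with a `Finset` source).
-/

namespace Summit.CriticalPhenomena.PercolationContinuityZ3.Cruxes.AdditiveGluing.StubIdeasGoodStepK1

open MeasureTheory Literature.Probability.LatticeModels Literature.Probability.Percolation
open scoped Classical BigOperators

/-- H5a (set-source BHK, one cluster = BHK 2006 Thm 1.2/1.3 for a SOURCE SET `S₀`; vdB–Kahn 2001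
Remark 3): given `{S₀ ↮ X}`, two increasing events determined by the union edge cluster of `S₀` are
positively correlated.  Denominator-free.  Proof route: `BHK2006.core`'s induction verbatim with
`rC U s` replaced by `⋃ s ∈ S₀, rC U s` (or identification of `S₀` by weight-1 edges when the events
only see `S₀` as a whole). -/
theorem bhk_oneCluster_setSource {V : Type*} [Fintype V] (w : Sym2 V → unitInterval)
    (S₀ : Finset V) (X : Set V) (A B : Set (BondConfig V))
    (hA : ∀ ω ω', ω ∈ A → (⋃ s ∈ S₀, openEdgeCluster ω s) ⊆ (⋃ s ∈ S₀, openEdgeCluster ω' s) → ω' ∈ A)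
    (hB : ∀ ω ω', ω ∈ B → (⋃ s ∈ S₀, openEdgeCluster ω s) ⊆ (⋃ s ∈ S₀, openEdgeCluster ω' s) → ω' ∈ B)
    (hX : Disjoint (↑S₀ : Set V) X) :
    (prodBernoulli w).real ({ω | ∀ s ∈ S₀, ∀ x ∈ X, ¬ (openGraph ω).Reachable s x} ∩ A) *
        (prodBernoulli w).real ({ω | ∀ s ∈ S₀, ∀ x ∈ X, ¬ (openGraph ω).Reachable s x} ∩ B) ≤
      (prodBernoulli w).real {ω | ∀ s ∈ S₀, ∀ x ∈ X, ¬ (openGraph ω).Reachable s x} *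
        (prodBernoulli w).real ({ω | ∀ s ∈ S₀, ∀ x ∈ X, ¬ (openGraph ω).Reachable s x} ∩ A ∩ B) := by
  sorry

/-- H5b (set-source BHK, two clusters = BHK 2006 Thm 1.4 / vdB–Kahn 2001 Thm 1.2 with Remark 3):
given `{S₀ ↮ t}`, an increasing event of the union cluster of `S₀` and an increasing event of the
cluster of `t` are negatively correlated. -/
theorem bhk_twoCluster_setSource {V : Type*} [Fintype V] (w : Sym2 V → unitInterval)
    (S₀ : Finset V) (t : V) (A B : Set (BondConfig V))
    (hA : ∀ ω ω', ω ∈ A → (⋃ s ∈ S₀, openEdgeCluster ω s) ⊆ (⋃ s ∈ S₀, openEdgeCluster ω' s) → ω' ∈ A)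
    (hB : ∀ ω ω', ω ∈ B → openEdgeCluster ω t ⊆ openEdgeCluster ω' t → ω' ∈ B) (ht : t ∉ S₀) :
    (prodBernoulli w).real {ω | ∀ s ∈ S₀, ¬ (openGraph ω).Reachable s t} *
        (prodBernoulli w).real ({ω | ∀ s ∈ S₀, ¬ (openGraph ω).Reachable s t} ∩ A ∩ B) ≤
      (prodBernoulli w).real ({ω | ∀ s ∈ S₀, ¬ (openGraph ω).Reachable s t} ∩ A) *
        (prodBernoulli w).real ({ω | ∀ s ∈ S₀, ¬ (openGraph ω).Reachable s t} ∩ B) := by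
  sorry

/-- H1 (KN Lemma 2 for the partition `{a₂,a₃} = {a₂} ⊔ {a₃}`, cross-multiplied, no denominators):
`φ(23) ≥ φ(2) + φ(3)` where `φ(X) = μ(o ↔ A(X) | A(X) ↮ A(Xᶜ))` inside `A' = {a₁,a₂,a₃}`.
Two applications of KN Lemma 1 = H5a with `S₀ = {a₂,a₃}` and the decreasing event `{a₂ ↮ a₃}`. -/
theorem knLemma2_pair (n : ℕ) (w : Sym2 (Fin n) → unitInterval) (o a₁ a₂ a₃ : Fin n) :
    (prodBernoulli w).real ({ω | ¬ (openGraph ω).Reachable a₂ a₁ ∧ ¬ (openGraph ω).Reachable a₂ a₃}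
        ∩ openConn o a₂) *
      (prodBernoulli w).real {ω | ¬ (openGraph ω).Reachable a₃ a₁ ∧ ¬ (openGraph ω).Reachable a₃ a₂} *
      (prodBernoulli w).real {ω | ¬ (openGraph ω).Reachable a₂ a₁ ∧ ¬ (openGraph ω).Reachable a₃ a₁}
    + (prodBernoulli w).real ({ω | ¬ (openGraph ω).Reachable a₃ a₁ ∧ ¬ (openGraph ω).Reachable a₃ a₂}
        ∩ openConn o a₃) *
      (prodBernoulli w).real {ω | ¬ (openGraph ω).Reachable a₂ a₁ ∧ ¬ (openGraph ω).Reachable a₂ a₃} *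
      (prodBernoulli w).real {ω | ¬ (openGraph ω).Reachable a₂ a₁ ∧ ¬ (openGraph ω).Reachable a₃ a₁}
    ≤ (prodBernoulli w).real ({ω | ¬ (openGraph ω).Reachable a₂ a₁ ∧ ¬ (openGraph ω).Reachable a₃ a₁}
        ∩ (openConn o a₂ ∪ openConn o a₃)) *
      (prodBernoulli w).real {ω | ¬ (openGraph ω).Reachable a₂ a₁ ∧ ¬ (openGraph ω).Reachable a₂ a₃} *
      (prodBernoulli w).real {ω | ¬ (openGraph ω).Reachable a₃ a₁ ∧ ¬ (openGraph ω).Reachable a₃ a₂} := by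
  sorry

/-- H2 (KN Theorem 2, pattern `I`, denominator-free; `a₁` is the designated worst relay):
`μ(D₂₃) · I ≥ μ({o ↔ A(23)} ∩ D₂₃) · (m₂₃ − m₁)` with `D₂₃ = {a₂ ↮ a₁, a₃ ↮ a₁}`,
`I = μ(o ↔ a₂ ↔ a₃ ↔ b, D₂₃) − μ(o ↔ A(23), a₁ ↔ b, D₂₃)`, `m₂₃ = μ(b↔a₂, b↔a₃, b↮a₁)`,
`m₁ = μ(b↔a₁, b↮a₂, b↮a₃)`.  One application of H5a and one of H5b with `S₀ = {a₂, a₃}`.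
(Patterns `II`, `III` are the single-source versions: tree `knLemma3i_oneCluster/_twoCluster`.) -/
theorem knThm2_patternI (n : ℕ) (w : Sym2 (Fin n) → unitInterval) (o a₁ a₂ a₃ b : Fin n)
    (h : a₁ ≠ a₂ ∧ a₁ ≠ a₃) :
    (prodBernoulli w).real ({ω | ¬ (openGraph ω).Reachable a₂ a₁ ∧ ¬ (openGraph ω).Reachable a₃ a₁}
        ∩ (openConn o a₂ ∪ openConn o a₃)) *
      ((prodBernoulli w).real (openConn b a₂ ∩ openConn b a₃ ∩ (openConn b a₁)ᶜ) -
        (prodBernoulli w).real (openConn b a₁ ∩ (openConn b a₂)ᶜ ∩ (openConn b a₃)ᶜ)) ≤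
    (prodBernoulli w).real {ω | ¬ (openGraph ω).Reachable a₂ a₁ ∧ ¬ (openGraph ω).Reachable a₃ a₁} *
      ((prodBernoulli w).real ({ω | ¬ (openGraph ω).Reachable a₂ a₁ ∧ ¬ (openGraph ω).Reachable a₃ a₁}
          ∩ (openConn o a₂ ∩ openConn a₂ a₃ ∩ openConn a₃ b)) -
        (prodBernoulli w).real ({ω | ¬ (openGraph ω).Reachable a₂ a₁ ∧ ¬ (openGraph ω).Reachable a₃ a₁}
          ∩ (openConn o a₂ ∪ openConn o a₃) ∩ openConn a₁ b)) := by
  sorry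

/-- H3 (KN Theorem 2 = Question 7 for three relays in the KN regime `m₁ ≤ m₂₃`; from H1, H2 and the
two single-source pattern bounds; arithmetic as on p. 9): if `a₁` is the `τ`-minimiser of
`{a₁,a₂,a₃}` and `m₁ ≤ m₂₃` then `μ(o ↔ A', a₁ ↔ b) ≤ μ(o ↔ b, o ↔ A')`, `A' = {a₁,a₂,a₃}`. -/
theorem knThm2 (n : ℕ) (w : Sym2 (Fin n) → unitInterval) (o a₁ a₂ a₃ b : Fin n)
    (hd : a₁ ≠ a₂ ∧ a₁ ≠ a₃ ∧ a₂ ≠ a₃)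
    (h₂ : (prodBernoulli w).real (openConn a₁ b) ≤ (prodBernoulli w).real (openConn a₂ b))
    (h₃ : (prodBernoulli w).real (openConn a₁ b) ≤ (prodBernoulli w).real (openConn a₃ b))
    (hm : (prodBernoulli w).real (openConn b a₁ ∩ (openConn b a₂)ᶜ ∩ (openConn b a₃)ᶜ) ≤
      (prodBernoulli w).real (openConn b a₂ ∩ openConn b a₃ ∩ (openConn b a₁)ᶜ)) :
    (prodBernoulli w).real ((openConn o a₁ ∪ openConn o a₂ ∪ openConn o a₃) ∩ openConn a₁ b) ≤
      (prodBernoulli w).real (openConn o b ∩ (openConn o a₁ ∪ openConn o a₂ ∪ openConn o a₃)) := by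
  sorry

/-- H4 (generalised KN Lemma 4 / inequality (9): after gluing ALL non-minimal relays `A''` into one
vertex, the minimal relay `a₁` is still the less reliable one — written glue-free:
`μ(b ↔ A'') − μ(b ↔ A'', a₁ ↔ A'', a₁ ↮ b) ≥ min_{a ∈ A''} μ(a ↔ b)`).  `A''.card = 2` is KN Lemma 4
(from the landed two-relay theorems `stub_goodStepTwoRelays_k41` / `knThm1Set…`); general `A''`:
0 violations in 5 500 exact random instances (|A''| = 2,3,4, n = 6); follows from KN Conj 2 in form (3). -/
theorem knLemma4_gen (n : ℕ) (w : Sym2 (Fin n) → unitInterval) (A'' : Finset (Fin n)) (a₁ b : Fin n)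
    (ha : a₁ ∉ A'') (hb : b ∉ A'') (hne : A''.Nonempty)
    (hmin : ∀ a ∈ A'', (prodBernoulli w).real (openConn a₁ b) ≤ (prodBernoulli w).real (openConn a b)) :
    ∃ a ∈ A'', (prodBernoulli w).real (openConn a b) ≤
      (prodBernoulli w).real (⋃ x ∈ A'', (openConn b x : Set (BondConfig (Fin n)))) -
        (prodBernoulli w).real ((⋃ x ∈ A'', (openConn b x : Set (BondConfig (Fin n)))) ∩
          (⋃ x ∈ A'', (openConn a₁ x : Set (BondConfig (Fin n)))) ∩ (openConn a₁ b)ᶜ) := by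
  sorry

/-- H6 (the k = 3 layer of the stub that the imports reach — to be registered as a partial-result stub
if the lead agrees): the conclusion of `stub_goodStep` for `A.card = 4` (three relays) under the KN-Theorem-2 side
condition on the worst relay, with NO induction hypothesis and no condition on the observer.
(`A.card ≤ 3` is landed unconditionally: `stub_goodStepTwoRelays_k41`, `stub_goodCardLeThree_k42`,
`stub_goodTwoRelays_k9`.) -/
theorem goodStep_cardFour_knRegime :
    ∀ (n : ℕ) (w : Sym2 (Fin n) → unitInterval) (A : Finset (Fin n)) (o b a₁ : Fin n),
      b ∈ A → o ∉ A → A.card = 4 → a₁ ∈ A → a₁ ≠ b →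
      (∀ a ∈ A, (prodBernoulli w).real (openConn a₁ b) ≤ (prodBernoulli w).real (openConn a b)) →
      -- KN regime: "b joined to a₁ alone" is at most as likely as "b joined to all other relays but not a₁"
      (prodBernoulli w).real (openConn b a₁ ∩ ⋂ a ∈ A.erase b \ {a₁}, (openConn b a : Set _)ᶜ) ≤
        (prodBernoulli w).real ((⋂ a ∈ A.erase b \ {a₁}, (openConn b a : Set _)) ∩ (openConn b a₁)ᶜ) →
      ∀ (t : ℝ) (sel : Finset (Fin n) → Fin n), (∀ W, sel W ∈ A) →
        (∀ a ∈ A, 1 - t ≤ (prodBernoulli w).real (openConn a b)) →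
        (prodBernoulli w).real ((⋃ a ∈ A, openConn o a) ∩ (openConn o b)ᶜ)
          + ∑ W ∈ (Finset.univ : Finset (Finset (Fin n))).filter (fun W => o ∈ W ∧ Disjoint W A),
              (prodBernoulli w).real {ω : BondConfig (Fin n) | openCluster ω o = (W : Set (Fin n))}
                * (prodBernoulli w).real (openConnIn ((W : Set (Fin n))ᶜ) (sel W) b)ᶜ
          ≤ t := by
  sorry

end Summit.CriticalPhenomena.PercolationContinuityZ3.Cruxes.AdditiveGluing.StubIdeasGoodStepK1
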